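import Mathlib
import Summits.Langlands.Langlands.Theses.QuadraticWindow
import Literature.NumberTheory.Automorphic.GaloisActionPlaces
import Literature.NumberTheory.Automorphic.GLnAdelicStructureProofs
import Literature.NumberTheory.Automorphic.BaseChangeInductionAlong
import Literature.NumberTheory.Automorphic.AsaiSign
import Literature.NumberTheory.Automorphic.UnitaryGroupAutomorphicRep
import Literature.NumberTheory.Automorphic.UnitaryLimitsOfDiscreteSeries
import Summits.Langlands.Langlands.Theorems.QuadraticWindowHostInducedRepPatchDescend
import Summits.Langlands.Langlands.Theorems.QuadraticWindowHostInducedRepInducedPackage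
import Summits.Langlands.Langlands.Theorems.QuadraticWindowHostInducedRepSignedTwistAux

/-!
# Line `grs-explicit-descent` — checked skeleton for the crux
`Summit.Langlands.Langlands.Theses.QuadraticWindow.HostInducedRep` (stmt-Langlands-10902)

Planner crux-plan, round 1.  The idea card `grs-explicit-descent` (ideator 2) was never published
to the crux directory (its folder is not mounted anywhere; all three triagers record this); by its
slug and the three triage notes it is the Ginzburg–Rallis–Soudry EXPLICIT (Fourier–Jacobi /
residual-Eisenstein) DESCENT lever, the same lever as the two published sibling cards
`generic-descent-without-endoscopy` (ideator 1) and `grs-generic-descent` (ideator 3), which all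
three triagers pass and ask to be MERGED into one line headed by the STRONG descent statement
(unramified correspondence at EVERY good place) and CHAINED with the sign-law lever of the cards
`one-transparent-pane ≈ flicker-period-sign-pin`.  This file is that merged line.

## Shape of the line (five registered stubs + the kernel-checked composition)

Write `Π := AI_{F/F₀}(π ⊗ ψ')` (`ψ'` the Hecke character with Artin avatar `eψ`), `K/F₀` a CM
quadratic extension, `τ' :=` a conjugate self-dual twist of `BC_{K/F₀}(Π)`, `σ :=` its descent to
the quasi-split unitary group `U_{K/F₀}(2n) = U(n,n)`, `r_σ` the Galois representation of `σ`.

* `stub_inducedPackage`   (S1, size M) — automorphic induction WITH CONTROL AT EVERY GUARDED PLACE: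
  a cuspidal `Π` on `GL_{2n}/F₀` whose Satake polynomial at every place `v` carrying guard data is
  the induced Satake polynomial of the twisted parameters `Sat(π,w)·c_w` (tree:
  `automorphicInduction_cyclic_cuspidal` is the a.e. form; the every-place form is Arthur–Clozel
  III.6 + local automorphic induction); riders: `ℓ ∤ disc F₀`, guarded places are cofinite.
* `stub_signedTwist`      (S2, size L; the SIGN LAW of the sibling cards lives here) — there is a
  finite set `T` of places of `F₀` such that for every CM quadratic `K/F₀` split at `T` and
  unramified above `ℓ`, and every auxiliary place `v₀`, there are a CUSPIDAL conjugate self-dual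
  `τ'` on `GL_{2n}/K` with the STANDARD Asai sign (`HasAsaiSign c 1`), half-integral doubly-regular
  archimedean exponents, unramified above `ℓ`, and an `ℓ`-adic character `θ` of `Γ_K` UNTWISTING
  the Goldring–Koskivirta Frobenius polynomials of `τ'` to the host polynomials of the crux
  (`scaleRoots` identities) at cofinitely many places and at all places over `v₀`.
* `stub_grsExplicitDescent` (S3, size XL, THE LEVER, hardest) — GRS descent for even quasi-split
  unitary groups: a conjugate self-dual cuspidal `P` on `GL_N/K` with standard Asai sign is the
  standard weak base change of a CUSPIDAL `σ` on `U_{K/F₀}(N)` which is moreover unramified with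
  the expected base-change Satake parameter at EVERY place `u` with `e(u∣v) = 1` where `P` is
  unramified at `u, c•u` (the STRONG clause = ideator 1's `GenericStrongDescent`, insisted on by
  all three triagers), and whose archimedean infinitesimal characters are those of `P` (archimedean
  compatibility, GRS/Kim–Krishnamurthy).
* `stub_gkPlacewise`      (S4, size XL) — Goldring–Koskivirta Thm 3.5.5 for cuspidal `σ` on the
  quasi-split `U_{K/F₀}(2n)` with half-integral doubly-regular infinitesimal characters, in a
  PLACEWISE form over `F₀` (Disproof.lean §6: the printed control set is indexed by rational
  primes; the crux demands every place) and twisted by an arbitrary `ℓ`-adic character `θ`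
  (`U → GU`, Kottwitz datum `B = K`, and the twist algebra are inside).
* `stub_patchDescend`     (S5, size M, pure Galois theory) — patching over the family of CM
  quadratic extensions of `F₀` split at `T` and above `ℓ` (tree: `SorensenPatching`,
  `SGeneralQuadraticFamily`, `QuadraticFamily.GoodPrime.exists_framedGaloisRep_of_compatibleAE`
  are PROVED) and reading the representation over `F₀` off the split members.
* `HostInducedRep_of : HostInducedRep` — the composition S1 → S2 → (∀ K: S3 → S4) → S5, proved
  here without `sorry` (first-order glue only; the `n = 0` stratum is excluded by the crux's own
  twist-nontriviality hypothesis, `pos_of_twistNontrivial`, copied from Disproof.lean §1).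

Vocabulary gaps (line card, Definition requests): the tree has no predicate "`σ_v` is a
non-degenerate limit of discrete series" and no "`σ` is globally generic"; the archimedean
interface between S3 and S4 is therefore the infinitesimal character (`UnitaryGroup.HasHCParameterAt`)
of shape `(k¹ ∣ k²)`, `k¹, k²` strictly decreasing in `½ + ℤ` (`HalfIntShape`), which is what the
intended objects satisfy (generic descent ⇒ large ⇒ NLDS `twinDatum`, Knapp–Zuckerman; tree
`isNondegenerateLimitOfDiscreteSeries_twinDatum`) and what GK's theorem needs up to that gap.
-/

open scoped BigOperators Polynomial Classical
open Filter Set Function Polynomial IsDedekindDomain NumberField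
open Literature.NumberTheory.Automorphic Literature.NumberTheory.GaloisRepresentations
open Summit.Langlands.Langlands.Theses.QuadraticWindow

set_option linter.dupNamespace false

noncomputable section

namespace Summit.Langlands.Langlands.Cruxes.HostInducedRep.GrsExplicitDescent

/-! ## Vocabulary of the line (abbreviations of verbatim sub-terms of the crux) -/

section Defs

variable {F₀ F : Type} [Field F₀] [NumberField F₀] [Field F] [NumberField F] [Algebra F₀ F]

-- `Hyps`, `Guard`, `IsInducedPackage` (landed with stub S1, p84505) and `hostPoly`, `sqPoly` (landed with
-- the S2 bookkeeping, p85734) now live in `Summit.Langlands.Langlands.Theorems.HostInducedRep.GrsExplicitDescent`;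
-- the skeleton uses THOSE declarations (byte-identical to the round-1 local copies) through the aliases below.
export Summit.Langlands.Langlands.Theorems.HostInducedRep.GrsExplicitDescent (Hyps Guard IsInducedPackage
  hostPoly sqPoly)

end Defs

/-- **Half-integral doubly-regular shape** of a multiset of `2n` complex numbers: `M = k¹ ∪ k²` for
two strictly decreasing `n`-tuples of half-integers `k¹, k² : Fin n → ½ + ℤ` (possibly equal).
This is the infinitesimal character `(k¹ ∣ k²)` of a non-degenerate limit of discrete series of
`U(n,n)` singular at noncompact roots only (`LDSDatum`, `twinDatum` when `k¹ = k²`; integrality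
`param ∈ ½ + ℤ` is forced for `U(n,n)`, `LDSDatum.param_ne_intCast`), and, on the `GL_{2n}(ℂ)` side,
the holomorphic-exponent multiset of a "type I" doubled parameter. -/
def HalfIntShape (n : ℕ) (M : Multiset ℂ) : Prop :=
  ∃ k₁ k₂ : Fin n → ℚ, StrictAnti k₁ ∧ StrictAnti k₂ ∧ (∀ t, ∃ m : ℤ, k₁ t = m + 1 / 2) ∧
    (∀ t, ∃ m : ℤ, k₂ t = m + 1 / 2) ∧
    M = (Finset.univ.val.map fun t ↦ ((k₁ t : ℚ) : ℂ)) + (Finset.univ.val.map fun t ↦ ((k₂ t : ℚ) : ℂ))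

section KLevel

variable {F₀ F : Type} [Field F₀] [NumberField F₀] [Field F] [NumberField F] [Algebra F₀ F]

/-- **Admissible CM quadratic extensions** `K/F₀` (with involution `cK`) for the level `ℓ` and the
finite set `T` of places of `F₀`: `[K:F₀] = 2`, `cK ≠ 1`, `K` totally complex (hence CM when `F₀`
is totally real), every place of `K` above `ℓ` unramified over `F₀`, and every `t ∈ T` split in
`K` (`e = f = 1` at the places above `t`).  The patching family of `stub_patchDescend`
(`F₀(√-D)`, `D` prime in a congruence class) consists of such `K`. -/
def Adm (ℓ : ℕ) (T : Finset (HeightOneSpectrum (𝓞 F₀))) (K : Type) [Field K] [NumberField K]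
    [Algebra F₀ K] (cK : K ≃ₐ[F₀] K) : Prop :=
  Module.finrank F₀ K = 2 ∧ cK ≠ 1 ∧ IsTotallyComplex K ∧
    (∀ u : HeightOneSpectrum (𝓞 K), ((ℓ : ℕ) : 𝓞 K) ∈ u.asIdeal →
      u.asIdeal.ramificationIdx (𝓞 F₀) = 1) ∧
    (∀ t ∈ T, ∀ u : HeightOneSpectrum (𝓞 K), u.under (𝓞 F₀) = t →
      u.asIdeal.ramificationIdx (𝓞 F₀) = 1 ∧ u.asIdeal.inertiaDeg (𝓞 F₀) = 1)

variable {K : Type} [Field K] [NumberField K] [Algebra F₀ K]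

/-- **Twist control at a place `u` of `K`** for the pair `(τ', θ)` of `stub_signedTwist`: for every
guard datum `(α, c)` at the place `v` of `F₀` below `u` with `v ∤ ℓ` and `e(u∣v) = 1`, `τ'` is
unramified at `u` and `cK • u`, and for every Satake parameter `β` of `τ'` at `u` the `ℓ`-adic
character `θ` has an arithmetic-Frobenius value `t` at `u` which UNTWISTS the Goldring–Koskivirta
Frobenius polynomial `arithFrobPolyOfSatake ι q_u (2n) β` to the host polynomial at `v`
(`f(u∣v) = 1`) resp. to its squares polynomial (`f(u∣v) = 2`):
`(∏_{b ∈ β} (X - ι⁻¹((q_u^{(2n-1)/2} b)⁻¹))).scaleRoots t`.  On paper, with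
`τ' = BC_K(Π) ⊗ ψ₀'`, `Sat(τ',u) = Sat(Π,v)^{f(u∣v)} · ψ₀'(ϖ_u)` and `t = ι⁻¹(q_u^{n/2} ψ₀'(ϖ_u))`,
the value at `Frob_u` of the avatar of the ALGEBRAIC character `ψ₀' ‖·‖^{-n/2}` (integral infinity
type exactly because the exponents of `τ'` lie in `½ + ℤ`). -/
def TwistCtrl {n : ℕ} {hcpt : isCompact_glFiniteIntegralLevel n F}
    (π : CuspidalAutomorphicRepData n F hcpt) (eψ : FramedGaloisRep F ℂ 1)
    {ℓ : ℕ} [Fact ℓ.Prime] (ι : PadicAlgCl ℓ ≃+* ℂ) (cK : K ≃ₐ[F₀] K)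
    {hcptK : isCompact_glFiniteIntegralLevel (2 * n) K}
    (τ' : CuspidalAutomorphicRepData (2 * n) K hcptK) (θ : FramedGaloisRep K (PadicAlgCl ℓ) 1)
    (u : HeightOneSpectrum (𝓞 K)) : Prop :=
  ∀ (α : HeightOneSpectrum (𝓞 F) → Multiset ℂ) (c : HeightOneSpectrum (𝓞 F) → ℂ),
    ((ℓ : ℕ) : 𝓞 F₀) ∉ (u.under (𝓞 F₀)).asIdeal → Guard π eψ (u.under (𝓞 F₀)) α c →
    u.asIdeal.ramificationIdx (𝓞 F₀) = 1 →
      τ'.1.IsUnramifiedAt u ∧ τ'.1.IsUnramifiedAt (cK • u) ∧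
      ∀ β : Multiset ℂ, τ'.1.HasSatakeParamAt u β →
        ∃ t : PadicAlgCl ℓ, θ.HasFrobCharpolyAt u (X - C t) ∧
          (u.asIdeal.inertiaDeg (𝓞 F₀) = 1 →
            (arithFrobPolyOfSatake ι u.residueCard (2 * n) β).scaleRoots t =
              hostPoly ι n α c (u.under (𝓞 F₀))) ∧
          (u.asIdeal.inertiaDeg (𝓞 F₀) = 2 →
            (arithFrobPolyOfSatake ι u.residueCard (2 * n) β).scaleRoots t =
              sqPoly (hostPoly ι n α c (u.under (𝓞 F₀))))

/-- **Specification of the signed twist `(τ', θ)` over `K` with auxiliary place `v₀`**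
(conclusion of `stub_signedTwist`): (a) `τ'` conjugate self-dual a.e. (`IsConjSelfDualAE`);
(b) STANDARD Asai sign (`HasAsaiSign cK 1`: `L^S(s, τ', As^{(-1)^{2n-1}}) = L^S(s, τ', As⁻)` has
the pole — the sign for which the descent to the quasi-split `U_{K/F₀}(2n)` along the standard
base change `ξ_1` exists); (c) archimedean parameter of half-integral doubly-regular shape at every
complex embedding (`HalfIntShape`: the "type I" condition = the SIGN LAW of the sibling cards);
(d) `τ'` unramified at `u` and `cK • u` for every place `u` above `ℓ` (which is unramified over
`F₀`); (e) twist control (`TwistCtrl`) at all but finitely many places of `K` and at every place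
above `v₀`. -/
def SignedTwistSpec {n : ℕ} {hcpt : isCompact_glFiniteIntegralLevel n F}
    (π : CuspidalAutomorphicRepData n F hcpt) (eψ : FramedGaloisRep F ℂ 1)
    {ℓ : ℕ} [Fact ℓ.Prime] (ι : PadicAlgCl ℓ ≃+* ℂ) (cK : K ≃ₐ[F₀] K)
    {hcptK : isCompact_glFiniteIntegralLevel (2 * n) K}
    (τ' : CuspidalAutomorphicRepData (2 * n) K hcptK) (θ : FramedGaloisRep K (PadicAlgCl ℓ) 1)
    (v₀ : HeightOneSpectrum (𝓞 F₀)) : Prop :=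
  τ'.1.IsConjSelfDualAE cK ∧ τ'.1.HasAsaiSign cK 1 ∧
  (∃ χ : (K →+* ℂ) → Multiset ℂ, τ'.1.HasArchParameter χ ∧ ∀ σe : K →+* ℂ, HalfIntShape n (χ σe)) ∧
  (∀ u : HeightOneSpectrum (𝓞 K), ((ℓ : ℕ) : 𝓞 K) ∈ u.asIdeal →
    u.asIdeal.ramificationIdx (𝓞 F₀) = 1 ∧ τ'.1.IsUnramifiedAt u ∧ τ'.1.IsUnramifiedAt (cK • u)) ∧
  (∀ᶠ u : HeightOneSpectrum (𝓞 K) in cofinite, TwistCtrl π eψ ι cK τ' θ u) ∧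
  (∀ u : HeightOneSpectrum (𝓞 K), u.under (𝓞 F₀) = v₀ → TwistCtrl π eψ ι cK τ' θ u)

end KLevel

/-- **Patch control at a place `u` of `K`** for the abstract patching lemma `stub_patchDescend`:
for every polynomial `P` controlled at the place `v` below `u` (`Ctrl v P`) and `e(u∣v) = 1`, the
representation `r` of `Γ_K` is unramified at `u` with arithmetic-Frobenius characteristic
polynomial `P` if `f(u∣v) = 1` and `sqPoly P` if `f(u∣v) = 2`. -/
def PatchCtrl {F₀ : Type} [Field F₀] [NumberField F₀] {K : Type} [Field K] [NumberField K]
    [Algebra F₀ K] {ℓ : ℕ} [Fact ℓ.Prime] {m : ℕ}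
    (Ctrl : HeightOneSpectrum (𝓞 F₀) → (PadicAlgCl ℓ)[X] → Prop)
    (r : FramedGaloisRep K (PadicAlgCl ℓ) m) (u : HeightOneSpectrum (𝓞 K)) : Prop :=
  ∀ P : (PadicAlgCl ℓ)[X], Ctrl (u.under (𝓞 F₀)) P → u.asIdeal.ramificationIdx (𝓞 F₀) = 1 →
    r.IsUnramifiedAt u ∧ (u.asIdeal.inertiaDeg (𝓞 F₀) = 1 → r.HasFrobCharpolyAt u P) ∧
      (u.asIdeal.inertiaDeg (𝓞 F₀) = 2 → r.HasFrobCharpolyAt u (sqPoly P))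

/-- **The controlled polynomials of the crux at a place `v` of `F₀`**: `v ∤ ℓ` and `P` is the host
polynomial of some guard datum `(α, c)` at `v` (all such `P` coincide, by uniqueness of Satake
parameters and of Frobenius values — Disproof.lean §5 — but the line never needs this). -/
def CtrlOf (F₀ : Type) {F : Type} [Field F₀] [NumberField F₀] [Field F] [NumberField F] [Algebra F₀ F]
    {n : ℕ} {hcpt : isCompact_glFiniteIntegralLevel n F}
    (π : CuspidalAutomorphicRepData n F hcpt) (eψ : FramedGaloisRep F ℂ 1)
    {ℓ : ℕ} [Fact ℓ.Prime] (ι : PadicAlgCl ℓ ≃+* ℂ) :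
    HeightOneSpectrum (𝓞 F₀) → (PadicAlgCl ℓ)[X] → Prop := fun v P ↦
  ((ℓ : ℕ) : 𝓞 F₀) ∉ v.asIdeal ∧
    ∃ (α : HeightOneSpectrum (𝓞 F) → Multiset ℂ) (c : HeightOneSpectrum (𝓞 F) → ℂ),
      Guard π eψ v α c ∧ P = hostPoly ι n α c v

/-! ## The five stubs -/

/-- **Fact-stub (S1′): every-unramified-place CUSPIDAL automorphic induction through a cyclic extension
of prime degree** — the Literature named fact
`Literature.NumberTheory.Automorphic.automorphicInduction_cyclic_cuspidal_unramified` (Arthur–Clozel 1989,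
Ch. 3, Thm. 4.2 (e) + Thm. 5.1 + Lemma 6.4; Henniart 2012, Thm. 3 + Thm. 5; landed p84234, UNPROVED in the
tree).  The round-1 stub `stub_inducedPackage` is PROVED from it
(`Theorems/QuadraticWindowHostInducedRepInducedPackage.lean`, p84505), so the only open content of S1 is this
published theorem. -/
theorem stub_factAI : Literature.NumberTheory.Automorphic.automorphicInduction_cyclic_cuspidal_unramified := by
  sorry

/-- **Stub S1 — the induced package with control at every guarded place (Arthur–Clozel
automorphic induction, every-place form; size M).**  Under the hypotheses of the crux there is a
CUSPIDAL automorphic representation `Π` of `GL_{2n}(𝔸_{F₀})` — on paper `Π = AI_{F/F₀}(π ⊗ ψ')`,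
`ψ'` the finite-order Hecke character of `F` whose value at a uniformizer `ϖ_w` is the
arithmetic-Frobenius value `c_w` of the Artin avatar `eψ` (class field theory; `π ⊗ ψ'` is
cuspidal and NOT `τ`-invariant by `hψnti`, so the induction is cuspidal, Arthur–Clozel Ch. 3,
Thm. 6.2 with Lemma 6.4 = tree fact `automorphicInduction_cyclic_cuspidal`) — such that at EVERY
place `v` of `F₀` carrying guard data `(α, c)` (every `w ∣ v` unramified over `F₀`, `π` with
Satake parameter `α_w`, `eψ` unramified with Frobenius value `c_w`) `Π` is unramified with Satake
polynomial the induced Satake polynomial of the twisted parameters `α_w c_w` (`IsInducedPackage`;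
the tree fact is the ALMOST-EVERYWHERE relation `IsAutomorphicInductionAlong`, the every-place
upgrade is local–global compatibility of automorphic induction at unramified places:
Arthur–Clozel Ch. 3 §6 with Ch. 1 §6, Henniart–Herb).  Riders (needed downstream by the patching
stub, consequences of the hypotheses): `ℓ ∤ disc F₀` (from `ℓ ∤ disc F`, `disc F₀² ∣ disc F`,
Mathlib `NumberField.not_dvd_discr_iff_isUnramifiedIn` + `Ideal.ramificationIdx_algebra_tower`), and
all but finitely many places `v` of `F₀` are prime to `ℓ` and carry guard data (Flath
`hasSatakeParamAt_cofinite_holds`; the Artin avatar `eψ` has finite image hence is unramified with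
a Frobenius value almost everywhere; `F/F₀` is unramified almost everywhere).  Uses the crux's
`hψnti` (cuspidality of the induction) and nothing archimedean. -/
theorem stub_inducedPackage :
    ∀ (F₀ F : Type) [Field F₀] [NumberField F₀] [Field F] [NumberField F] [Algebra F₀ F]
      (τ : F ≃ₐ[F₀] F) (n : ℕ) (hcpt : isCompact_glFiniteIntegralLevel n F)
      (π : CuspidalAutomorphicRepData n F hcpt) (e : FramedGaloisRep F₀ ℂ 1) (k : ℤ)
      (ℓ : ℕ) [Fact ℓ.Prime] (eψ : FramedGaloisRep F ℂ 1),
      Hyps τ n π e k ℓ eψ →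
      ∃ PInd : CuspidalAutomorphicRepData (2 * n) F₀ (isCompact_glFiniteIntegralLevel_holds (2 * n) F₀),
        IsInducedPackage π eψ PInd ∧ ¬ ((ℓ : ℤ) ∣ NumberField.discr F₀) ∧
        ∀ᶠ v : HeightOneSpectrum (𝓞 F₀) in cofinite, ((ℓ : ℕ) : 𝓞 F₀) ∉ v.asIdeal ∧
          ∃ (α : HeightOneSpectrum (𝓞 F) → Multiset ℂ) (c : HeightOneSpectrum (𝓞 F) → ℂ),
            Guard π eψ v α c :=
  Summit.Langlands.Langlands.Theorems.HostInducedRep.GrsExplicitDescent.stub_inducedPackage_of_automorphicInduction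
    stub_factAI

/-- **Stub S2 — the signed conjugate self-dual twist over admissible CM quadratic fields
(base change + class field theory + THE SIGN LAW; size L).**  Under the hypotheses of the crux and
given the induced package `Π` of S1, there is a finite set `T` of places of `F₀` (on paper: one
place `t_ω` with `ω(t_ω) ≠ 1` for each of the finitely many non-trivial self-twists `Π ≅ Π ⊗ ω`,
among them `ω_{F/F₀}`, so that `Π ≇ Π ⊗ ω_{K/F₀}` and `BC_{K/F₀}(Π)` is CUSPIDAL for every `K`
split at `T`, Arthur–Clozel Ch. 3 Thm. 4.2) such that for every admissible `K` (`Adm`: CM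
quadratic over `F₀` with involution `cK`, split at `T`, unramified above `ℓ`) and every auxiliary
place `v₀` of `F₀` there are a cuspidal `τ'` on `GL_{2n}/K` and an `ℓ`-adic character
`θ : Γ_K → ℚ̄_ℓ^×` with `SignedTwistSpec`: on paper `τ' = BC_K(Π) ⊗ ψ₀'` where `ψ₀'` is a Hecke
character of `K` with `ψ₀' (ψ₀')^c = (η* ∘ N_{K/F₀})⁻¹` (times a conjugate-symplectic unitary
character of half-integral infinity type when `n` is odd), `η* ∈ {η, η ω_{F/F₀}}` the polarization
character of `Π` with CONSTANT sign at the real places (this is where `hpar` and the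
`e ↔ e·ω_{F/F₀}` switch enter: Disproof.lean §8bis, evidence note `polarized_transfer`;
BLGGT arXiv:1010.2561 Lemma A.2.5 supplies `ψ₀'` unramified above `ℓ` and above `v₀`), chosen in
the conjugate-SYMPLECTIC class, so that (a) `τ'` is conjugate self-dual, (b) its Asai sign is the
standard one `HasAsaiSign cK 1` (Flicker–Rallis/Shahidi dichotomy `Mok2014_partialAsaiL_pole_dichotomy`
+ the flip by a conjugate-symplectic character), and (c) AT THE SAME TIME every archimedean exponent
multiset is of half-integral doubly-regular shape `(k¹ ∣ k²)` (`HalfIntShape`): the compatibility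
of (b) and (c) is the SIGN LAW — lever of the sibling cards `one-transparent-pane ≈
flicker-period-sign-pin`: at a complex place of `F` the `F/F₀`-Asai pole gives a Flicker–Rallis
period, hence local `(GL_n(ℝ), μ)`-distinction of `π'_w`, and Kemarsky's necessary condition
[Kem15, Thm 1.3] = Pattanayak–Wu–Zhang arXiv:2501.14449 Thm 3.1/3.3 pins `μ_v(-1) = (-1)^{n-1+k}`,
i.e. type I at every real place (triage r1-1 §B, r1-2 §A, r1-3 §derivation re-derived it
independently; automatic for odd `n` by central characters).  (d) `τ'` is unramified above `ℓ`
(`hunr`, `hψunr`, `K` unramified above `ℓ`, `ψ₀'` unramified above `ℓ`).  (e) The untwisting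
character `θ` is the `ℓ`-adic avatar of the ALGEBRAIC Hecke character `ψ₀' ‖·‖^{-n/2}` (Weil;
tree `HeckeCharacterGaloisAvatarProofs`), and the `scaleRoots` identities of `TwistCtrl` are the
bookkeeping `Sat(τ',u) = Sat(Π,v)^{f(u∣v)} ψ₀'(ϖ_u)` (base change, Arthur–Clozel Ch. 3 Thm. 4.2 at
every unramified place), `Sat(Π,v) =` the `f(w∣v)`-th roots of the `α_w c_w` (S1), and
`roots(hostPoly) = {ι⁻¹(q_v^{-(n-1)/2} b⁻¹) : b ∈ Sat(Π,v)}`; they hold at all places where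
`ψ₀'` is unramified — all but finitely many, and all places above `v₀` by the choice of `ψ₀'`.
Honours Disproof.lean: uses `hpar` (and possibly `hodd`) exactly where §7/§8bis say the engine needs
them; the `n = 1` calibration of triage r1-1 §C / r1-3 is the first unit test. -/
theorem stub_signedTwist :
    ∀ (F₀ F : Type) [Field F₀] [NumberField F₀] [Field F] [NumberField F] [Algebra F₀ F]
      (τ : F ≃ₐ[F₀] F) (n : ℕ) (hcpt : isCompact_glFiniteIntegralLevel n F)
      (π : CuspidalAutomorphicRepData n F hcpt) (e : FramedGaloisRep F₀ ℂ 1) (k : ℤ)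
      (ℓ : ℕ) [Fact ℓ.Prime] (ι : PadicAlgCl ℓ ≃+* ℂ) (eψ : FramedGaloisRep F ℂ 1),
      Hyps τ n π e k ℓ eψ →
      ∀ PInd : CuspidalAutomorphicRepData (2 * n) F₀ (isCompact_glFiniteIntegralLevel_holds (2 * n) F₀),
        IsInducedPackage π eψ PInd →
        ∃ T : Finset (HeightOneSpectrum (𝓞 F₀)),
          ∀ (K : Type) [Field K] [NumberField K] [Algebra F₀ K] (cK : K ≃ₐ[F₀] K),
            Adm ℓ T K cK → ∀ v₀ : HeightOneSpectrum (𝓞 F₀),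
              ∃ (τ' : CuspidalAutomorphicRepData (2 * n) K (isCompact_glFiniteIntegralLevel_holds (2 * n) K))
                (θ : FramedGaloisRep K (PadicAlgCl ℓ) 1), SignedTwistSpec π eψ ι cK τ' θ v₀ := by
  sorry

/-- **Stub S3 — THE LEVER: Ginzburg–Rallis–Soudry explicit descent to the quasi-split unitary
group, strong form (size XL, hardest).**  Let `K/F₀` be a quadratic extension of number fields with
non-trivial automorphism `cK`, `N ≥ 1`, and `P` a CUSPIDAL automorphic representation of
`GL_N(𝔸_K)` which is conjugate self-dual (a.e. on Satake parameters) with the standard Asai sign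
(`HasAsaiSign cK 1`: `L^S(s, P, As^{(-1)^{N-1}})` has its pole at `s = 1`).  Then there is a
CUSPIDAL automorphic representation `σ` of Mok's quasi-split `U_{K/F₀}(N)(𝔸_{F₀})` such that
(i) `P` is the standard weak base change of `σ` (`IsWeakBaseChange`, a.e.); (ii) STRONG clause: at
EVERY finite place `u` of `K` unramified over `F₀` at which `P` is unramified (at `u` and `cK • u`),
`σ` has a hyperspecial-spherical vector with base-change Satake parameter the Satake parameter of
`P` at `u` (`HasBaseChangeSatakeAt`); (iii) archimedean compatibility on infinitesimal characters:
at every complex place `w` of `K` fixed by `cK` the Harish-Chandra parameter of `σ_{w∣F₀}`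
(`HasHCParameterAt`) is the archimedean parameter of `P` at an embedding defining `w`.
Intended proof (trace-formula-free): `σ :=` an irreducible summand of the GRS descent — the space of
Fourier–Jacobi coefficients of the residue at the Asai pole of the Siegel-type Eisenstein series on
`U_{K/F₀}(2N)` induced from `P` — which is non-zero, CUSPIDAL and globally GENERIC with weak lift
`P` (Ginzburg–Rallis–Soudry 2011, doi:10.1142/7742, Ch. 3 and Ch. 11 (Thm "Langlands (weak)
functorial lift and descent"); announcement Ann. of Math. 150 (1999); Soudry, Astérisque 298 (2005);
Morimoto, Trans. AMS 370 (2018) doi:10.1090/tran/7119 for EVEN unitary groups; restated in the held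
book Getz–Hahn 2024 Thm 13.7.4 with Thm 13.7.1 = Cogdell–Kim–PS–Shahidi / Kim–Krishnamurthy IMRP
2005 strong generic transfer `U_{2n} → Res GL_{2n}` "functorial at all archimedean places and all
finite places where unramified"); (ii) from genericity: the Kim–Krishnamurthy lift of `σ` is `P` by
strong multiplicity one, so at `u` with `P_u` unramified `σ_u` is generic with unramified
`γ`-factors, hence spherical with the matching parameter (GRS Ch. 11 unramified correspondence;
for the dyadic / residual places a local converse theorem for generic representations of
`U(n,n)(F₀,v)`, Morimoto 2018, Q. Zhang arXiv:1509.00900, Atobe 2025 doi:10.1017/fms.2025.2);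
(iii) = the archimedean part of the same functoriality.  WHY IT MIGHT FAIL (triage r1-1 K2,
r1-2 (α)(β), r1-3 sharpen (a)): the printed unramified correspondence may exclude places above 2 or
where the additive character ramifies, and newform theory for generic representations of EVEN
quasi-split unitary groups at inert places is recent — the clause "EVERY `u` with `e(u∣v) = 1`" is
exactly what the crux's controlled set consumes, so it is kept strong here.  Barrier
`TwistedEndoscopySelfDual`: its conditionality clause (TWFL, Mok) is evaded — this is evasion (iv)
catalogued in the barrier file — and its self-duality clause is respected (`P` conjugate self-dual).
Genericity of `σ` is not expressible in the tree yet (definition request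
`UnitaryGroup.IsGloballyGeneric`); the stub records its CONSEQUENCES (ii), (iii). -/
theorem stub_grsExplicitDescent :
    ∀ (F₀ K : Type) [Field F₀] [NumberField F₀] [Field K] [NumberField K] [Algebra F₀ K]
      (cK : K ≃ₐ[F₀] K), Module.finrank F₀ K = 2 → ∀ (hc : cK ≠ 1) (N : ℕ)
      (hcptK : isCompact_glFiniteIntegralLevel N K) (P : CuspidalAutomorphicRepData N K hcptK),
      0 < N → P.1.IsConjSelfDualAE cK → P.1.HasAsaiSign cK 1 →
      ∃ σ : UnitaryGroup.CuspidalAutomorphicRepData F₀ K cK N hcptK,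
        UnitaryGroup.IsWeakBaseChange F₀ K cK N hcptK P.1 σ.1 ∧
        (∀ (u : HeightOneSpectrum (𝓞 K)) (β : Multiset ℂ), u.asIdeal.ramificationIdx (𝓞 F₀) = 1 →
          P.1.HasSatakeParamAt u β → P.1.IsUnramifiedAt (cK • u) →
          UnitaryGroup.HasBaseChangeSatakeAt F₀ K cK N hcptK σ.1 u β) ∧
        (∀ χ : (K →+* ℂ) → Multiset ℂ, P.1.HasArchParameter χ →
          ∀ (w : {w : InfinitePlace K // w.IsComplex}) (hw : cK • w.1 = w.1),
            ∃ σe : K →+* ℂ, InfinitePlace.mk σe = w.1 ∧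
              UnitaryGroup.HasHCParameterAt F₀ K cK N (StdForm.antidiagonal N) hcptK σ.1 hw hc
                (χ σe)) := by
  sorry

/-- **Stub S4 — Goldring–Koskivirta Thm 3.5.5 for the quasi-split `U_{K/F₀}(2n)`, PLACEWISE over
`F₀` and twisted (size XL).**  Let `F₀` be totally real, `K/F₀` a totally complex (hence CM)
quadratic extension with involution `cK ≠ 1`, `ℓ` a prime unramified in `F₀` and such that the
places of `K` above `ℓ` are unramified over `F₀` (so `ℓ ∉ Ram(G)` for `G = GU_{K/F₀}(n,n)/ℚ`),
`ι : ℚ̄_ℓ ≃ ℂ`, and `σ` a CUSPIDAL automorphic representation of the quasi-split `U_{K/F₀}(2n)`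
which is unramified above `ℓ` and whose infinitesimal character at every real place of `F₀` (every
complex place `w` of `K`, all fixed by `cK`) is of half-integral doubly-regular shape `(k¹ ∣ k²)`
(`HalfIntShape` — the infinitesimal character of a non-degenerate limit of discrete series of
`U(n,n)` singular only at noncompact roots; C-algebraic).  Then for every `ℓ`-adic character
`θ : Γ_K → ℚ̄_ℓ^×` there is a continuous semisimple `r : Γ_K → GL_{2n}(ℚ̄_ℓ)` — on paper
`r = ρ_{σ,ι} ⊗ θ` — such that at EVERY finite place `u` of `K` with `u ∤ ℓ` (read on `F₀`),
`e(u∣F₀) = 1`, `σ` hyperspecial-unramified at `u` with base-change Satake parameter `β`, and `θ`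
with arithmetic-Frobenius value `t` at `u`: `r` is unramified at `u` with characteristic polynomial
`(arithFrobPolyOfSatake ι q_u (2n) β).scaleRoots t = ∏_{b ∈ β} (X - t ι⁻¹((q_u^{(2n-1)/2} b)⁻¹))`
(the tree's Harris–Lan–Taylor–Thorne / Clozel normalisation of `rec(BC(σ)_u ⊗ |·|^{(1-2n)/2})`,
twisted).  Intended proof: extend `σ` to the unitary similitude group `GU_{K/F₀}(n,n)`
(Clozel–Harris–Labesse; the route's Sorensen2020 doi:10.1017/9781108649711.012), whose PEL datum
(`B = K`, `V = K^{2n}`, signature `(n,n)` at every real place) is a unitary Kottwitz datum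
(Goldring 2014 doi:10.1112/s0010437x13007355 §2 — acq-02542 — and GK Rem. 3.4.4); `σ_∞` is a
C-algebraic non-degenerate limit of discrete series (THIS is where the tree's vocabulary is short:
only the infinitesimal character is typed — definition request
`UnitaryGroup.IsLimitOfDiscreteSeriesAt`; the intended `σ` is the GENERIC descent of S3, whose
archimedean components are the large members `twinDatum … ε_gen` of the type-I packet, all `2^n`
members of which are non-degenerate LDS, tree `isNondegenerateLimitOfDiscreteSeries_twinDatum`;
triage r1-2/r1-3 checked the R-group `(ℤ/2)^n` bookkeeping); apply Goldring–Koskivirta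
arXiv:1507.05032 Thm 3.5.5 / Thm 11.1 (read p. 19; alternative engines Pilloni–Stroh 2016, Boxer
arXiv:1507.05922); twist by `θ` (`char(t·A) = char(A).scaleRoots t`).  PLACEWISE STRENGTHENING
(Disproof.lean §6, `HostInducedRepRatControl`): GK's printed control set is "all `w` over rational
`p ∉ Ram(G) ∪ Ram(π)`", `Ram(G) ⊇ {p ∣ disc F₀}`; the crux demands every place `v ∤ ℓ` of `F₀`, so
this stub asserts compatibility at `u` as soon as `σ` is unramified at `u`.  The placewise form IS
the shape printed by Fakhruddin–Pilloni 2021, Thm 9.10 (2) (`WD(r|_{Γ_{K_v}})^{F-ss} = rec(Π_v ⊗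
|det|^{(1-N)/2})` at EVERY `v ∤ ℓ`, for weakly regular odd conjugate self-dual `Π`; their descent
Thm 9.6 uses Mok, which this line replaces by S3, but their coherent-cohomology-to-Galois step with
full local–global compatibility away from `ℓ` — re-proved and extended to `p` by Boxer–Pilloni 2021
Thm 6.11 (higher Coleman theory) — is exactly the engine this stub needs; cf. the gen-2 sketch
`Cruxes/HostInducedRep/SketchIdeator3.lean §3 FPWeaklyRegularOddCM`); with GK alone the fallback is
the rational-prime version + the planner repair of Disproof §6.
Barriers: `NonRegularWeightBarrier` entered on purpose in its NLDS stratum (strata Hasse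
invariants); `ShimuraVarietyRealizationBarrier` evaded by the transfer to `GU(n,n)`. -/
theorem stub_gkPlacewise :
    ∀ (F₀ K : Type) [Field F₀] [NumberField F₀] [Field K] [NumberField K] [Algebra F₀ K]
      (cK : K ≃ₐ[F₀] K), IsTotallyReal F₀ → Module.finrank F₀ K = 2 → ∀ (hc : cK ≠ 1),
      IsTotallyComplex K → ∀ (n : ℕ) (ℓ : ℕ) [Fact ℓ.Prime] (ι : PadicAlgCl ℓ ≃+* ℂ),
      ¬ ((ℓ : ℤ) ∣ NumberField.discr F₀) →
      (∀ u : HeightOneSpectrum (𝓞 K), ((ℓ : ℕ) : 𝓞 K) ∈ u.asIdeal →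
        u.asIdeal.ramificationIdx (𝓞 F₀) = 1) →
      ∀ (hcptK : isCompact_glFiniteIntegralLevel (2 * n) K)
        (σ : UnitaryGroup.CuspidalAutomorphicRepData F₀ K cK (2 * n) hcptK),
        (∀ (w : {w : InfinitePlace K // w.IsComplex}) (hw : cK • w.1 = w.1), ∃ Λ : Multiset ℂ,
          UnitaryGroup.HasHCParameterAt F₀ K cK (2 * n) (StdForm.antidiagonal (2 * n)) hcptK σ.1 hw hc Λ ∧
            ∃ k₁ k₂ : Fin n → ℚ, StrictAnti k₁ ∧ StrictAnti k₂ ∧ (∀ t, ∃ m : ℤ, k₁ t = m + 1 / 2) ∧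
              (∀ t, ∃ m : ℤ, k₂ t = m + 1 / 2) ∧
              Λ = (Finset.univ.val.map fun t ↦ ((k₁ t : ℚ) : ℂ)) +
                (Finset.univ.val.map fun t ↦ ((k₂ t : ℚ) : ℂ))) →
        (∀ u : HeightOneSpectrum (𝓞 K), ((ℓ : ℕ) : 𝓞 K) ∈ u.asIdeal →
          UnitaryGroup.IsUnramifiedAt F₀ K cK (2 * n) hcptK σ.1 u) →
        ∀ θ : FramedGaloisRep K (PadicAlgCl ℓ) 1,
          ∃ r : FramedGaloisRep K (PadicAlgCl ℓ) (2 * n), r.toGaloisRep.IsSemisimple ∧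
            ∀ (u : HeightOneSpectrum (𝓞 K)) (β : Multiset ℂ) (t : PadicAlgCl ℓ),
              ((ℓ : ℕ) : 𝓞 F₀) ∉ (u.under (𝓞 F₀)).asIdeal →
              u.asIdeal.ramificationIdx (𝓞 F₀) = 1 →
              UnitaryGroup.HasBaseChangeSatakeAt F₀ K cK (2 * n) hcptK σ.1 u β →
              θ.HasFrobCharpolyAt u (X - C t) →
                r.IsUnramifiedAt u ∧
                  r.HasFrobCharpolyAt u ((arithFrobPolyOfSatake ι u.residueCard (2 * n) β).scaleRoots t) := by
  sorry

/-- **Stub S5 — patching over the CM quadratic extensions of `F₀` split at `T` and above `ℓ`, and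
descent of the control to `F₀` (pure Galois theory + Dirichlet; size M).**  Let `F₀` be a number
field, `ℓ` a prime, `m` a rank, `T` a finite set of places of `F₀`, and `Ctrl v P` an abstract
"controlled polynomial at `v`" predicate such that all but finitely many `v` carry a controlled
polynomial.  Suppose that for every ADMISSIBLE `K` (`Adm`: quadratic, totally complex, involution
`cK ≠ 1`, places above `ℓ` unramified over `F₀`, every `t ∈ T` split) and every place `v₀` of `F₀`
there is a continuous semisimple `r_{K,v₀} : Γ_K → GL_m(ℚ̄_ℓ)` with patch control (`PatchCtrl`:
unramified with characteristic polynomial `P`, resp. `sqPoly P`, at the places `u` with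
`e(u∣v) = 1` and `f(u∣v) = 1`, resp. `2`, above a place `v` with `Ctrl v P`) at all but finitely
many places of `K` AND at every place above `v₀`.  Then there is a continuous semisimple
`R : Γ_{F₀} → GL_m(ℚ̄_ℓ)` unramified with characteristic polynomial `P` at every `v` with
`Ctrl v P`.  Intended proof, ENTIRELY WITH PROVED TREE MATERIAL: the family `K_D = F₀(√-D)`
(`QuadraticFamily.sqrtNegField`), `D` prime with `8ℓq_T ∣ D + 1` (`q_T` = the rational primes below
`T`), is admissible (`PatchingFamily.isTotallyComplex_sqrtNegField`; `ℓ` and the `q_t` split in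
`ℚ(√-D)` by `QuadraticFamily.isSquare_adicCompletion_neg_natCast` +
`QuadraticExtension.ncard_finitePlacesOver_eq_two_of_isSquare`, hence `e = f = 1` above them by
`ramificationIdxIn_eq_one_of_ncard_eq_finrank`) and `∅`-general (`QuadraticFamily.GoodPrime.sGeneral`);
fix `v*` and put `ρ_D := r_{K_D,v*}`; almost-everywhere patch control makes each `ρ_D`
`CompatibleAE` with the datum `E v := roots(P_v)` (a characteristic polynomial over the
algebraically closed `ℚ̄_ℓ` is monic and split, so `P = ∏_{a ∈ roots P}(X - a)` and
`sqPoly P = frobPoly E v 2`), so Sorensen's hypotheses (a), (b) hold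
(`CompatibleAE.nonempty_equiv_outerConj`, `GoodPrime.exists_conj` — Chebotarev + Brauer–Nesbitt)
and `GoodPrime.exists_framedGaloisRep_of_compatibleAE` patches them to `R` with control at every
controlled `v`, the member split at `v` being `K_D` with `D` from `GoodPrime.exists_dvd_split` and
its control above `v` transported from `r_{K_D,v}` to `ρ_D ≅ r_{K_D,v}`
(`CompatibleAE.nonempty_equiv`, `isUnramifiedAt_of_equiv`, `hasFrobCharpolyAt_of_equiv`).
References: Sorensen, *A patching lemma* §1 Lemma 2 and Example (Sorensen2020); Harris–Taylor,
proof of Thm VII.1.9; Harris–Lan–Taylor–Thorne, proof of Cor 7.14. -/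
theorem stub_patchDescend :
    ∀ (F₀ : Type) [Field F₀] [NumberField F₀] (ℓ : ℕ) [Fact ℓ.Prime] (m : ℕ)
      (T : Finset (HeightOneSpectrum (𝓞 F₀)))
      (Ctrl : HeightOneSpectrum (𝓞 F₀) → (PadicAlgCl ℓ)[X] → Prop),
      (∀ᶠ v : HeightOneSpectrum (𝓞 F₀) in cofinite, ∃ P, Ctrl v P) →
      (∀ (K : Type) [Field K] [NumberField K] [Algebra F₀ K] (cK : K ≃ₐ[F₀] K),
        (Module.finrank F₀ K = 2 ∧ cK ≠ 1 ∧ IsTotallyComplex K ∧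
          (∀ u : HeightOneSpectrum (𝓞 K), ((ℓ : ℕ) : 𝓞 K) ∈ u.asIdeal →
            u.asIdeal.ramificationIdx (𝓞 F₀) = 1) ∧
          (∀ t ∈ T, ∀ u : HeightOneSpectrum (𝓞 K), u.under (𝓞 F₀) = t →
            u.asIdeal.ramificationIdx (𝓞 F₀) = 1 ∧ u.asIdeal.inertiaDeg (𝓞 F₀) = 1)) →
        ∀ v₀ : HeightOneSpectrum (𝓞 F₀), ∃ r : FramedGaloisRep K (PadicAlgCl ℓ) m,
          r.toGaloisRep.IsSemisimple ∧
          (∀ᶠ u : HeightOneSpectrum (𝓞 K) in cofinite,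
            ∀ P : (PadicAlgCl ℓ)[X], Ctrl (u.under (𝓞 F₀)) P → u.asIdeal.ramificationIdx (𝓞 F₀) = 1 →
              r.IsUnramifiedAt u ∧ (u.asIdeal.inertiaDeg (𝓞 F₀) = 1 → r.HasFrobCharpolyAt u P) ∧
                (u.asIdeal.inertiaDeg (𝓞 F₀) = 2 →
                  r.HasFrobCharpolyAt u (P.roots.map fun a ↦ X - C (a ^ 2)).prod)) ∧
          ∀ u : HeightOneSpectrum (𝓞 K), u.under (𝓞 F₀) = v₀ →
            ∀ P : (PadicAlgCl ℓ)[X], Ctrl (u.under (𝓞 F₀)) P → u.asIdeal.ramificationIdx (𝓞 F₀) = 1 →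
              r.IsUnramifiedAt u ∧ (u.asIdeal.inertiaDeg (𝓞 F₀) = 1 → r.HasFrobCharpolyAt u P) ∧
                (u.asIdeal.inertiaDeg (𝓞 F₀) = 2 →
                  r.HasFrobCharpolyAt u (P.roots.map fun a ↦ X - C (a ^ 2)).prod)) →
      ∃ R : FramedGaloisRep F₀ (PadicAlgCl ℓ) m, R.toGaloisRep.IsSemisimple ∧
        ∀ (v : HeightOneSpectrum (𝓞 F₀)) (P : (PadicAlgCl ℓ)[X]), Ctrl v P →
          R.IsUnramifiedAt v ∧ R.HasFrobCharpolyAt v P :=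
  Summit.Langlands.Langlands.Theorems.HostInducedRep.GrsExplicitDescent.stub_patchDescend

/-! ## Glue (proved): the `n = 0` stratum and the K-level assembly -/

/-- The twist-nontriviality hypothesis of the crux forces `0 < n` (a Satake parameter has
`card = n`; copy of Disproof.lean §1 `pos_of_twistNontrivial`). -/
theorem pos_of_twistNontrivial {n : ℕ} {F : Type} [Field F] [NumberField F]
    {hcpt : isCompact_glFiniteIntegralLevel n F} (π : CuspidalAutomorphicRepData n F hcpt)
    {l : Filter (HeightOneSpectrum (𝓞 F))} (g : HeightOneSpectrum (𝓞 F) → HeightOneSpectrum (𝓞 F))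
    (P Q : HeightOneSpectrum (𝓞 F) → ℂ → Prop)
    (h : ∃ᶠ w in l, ∃ (α β : Multiset ℂ) (c c' : ℂ), π.1.HasSatakeParamAt w α ∧
      π.1.HasSatakeParamAt (g w) β ∧ P w c ∧ Q w c' ∧ β.map (fun b ↦ b * c') ≠ α.map (fun a ↦ a * c)) :
    0 < n := by
  obtain ⟨w, α, β, c, c', hα, hβ, -, -, hne⟩ := h.exists
  by_contra hn
  obtain rfl : n = 0 := Nat.eq_zero_of_not_pos hn
  have hα0 : α = 0 := Multiset.card_eq_zero.mp hα.card_eq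
  have hβ0 : β = 0 := Multiset.card_eq_zero.mp hβ.card_eq
  exact hne (by rw [hα0, hβ0, Multiset.map_zero, Multiset.map_zero])

section Assembly

variable {F₀ F : Type} [Field F₀] [NumberField F₀] [Field F] [NumberField F] [Algebra F₀ F]
  {K : Type} [Field K] [NumberField K] [Algebra F₀ K]

/-- **K-level glue.**  Twist control of `(τ', θ)` at `u` (S2), the strong descent clause for
`σ` (S3) and the twisted Goldring–Koskivirta output for `r` (S4) give patch control of `r` at `u`
for the controlled polynomials `Ctrl v P :↔ v ∤ ℓ ∧ ∃ α c, Guard v α c ∧ P = hostPoly v α c`. -/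
theorem patchCtrl_of_twistCtrl {n : ℕ} {hcpt : isCompact_glFiniteIntegralLevel n F}
    (π : CuspidalAutomorphicRepData n F hcpt) (eψ : FramedGaloisRep F ℂ 1)
    {ℓ : ℕ} [Fact ℓ.Prime] (ι : PadicAlgCl ℓ ≃+* ℂ) (cK : K ≃ₐ[F₀] K)
    {hcptK : isCompact_glFiniteIntegralLevel (2 * n) K}
    (τ' : CuspidalAutomorphicRepData (2 * n) K hcptK) (θ : FramedGaloisRep K (PadicAlgCl ℓ) 1)
    (σ : UnitaryGroup.CuspidalAutomorphicRepData F₀ K cK (2 * n) hcptK)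
    (r : FramedGaloisRep K (PadicAlgCl ℓ) (2 * n))
    (hstrong : ∀ (u : HeightOneSpectrum (𝓞 K)) (β : Multiset ℂ),
      u.asIdeal.ramificationIdx (𝓞 F₀) = 1 → τ'.1.HasSatakeParamAt u β →
      τ'.1.IsUnramifiedAt (cK • u) → UnitaryGroup.HasBaseChangeSatakeAt F₀ K cK (2 * n) hcptK σ.1 u β)
    (hr : ∀ (u : HeightOneSpectrum (𝓞 K)) (β : Multiset ℂ) (t : PadicAlgCl ℓ),
      ((ℓ : ℕ) : 𝓞 F₀) ∉ (u.under (𝓞 F₀)).asIdeal → u.asIdeal.ramificationIdx (𝓞 F₀) = 1 →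
      UnitaryGroup.HasBaseChangeSatakeAt F₀ K cK (2 * n) hcptK σ.1 u β →
      θ.HasFrobCharpolyAt u (X - C t) →
        r.IsUnramifiedAt u ∧
          r.HasFrobCharpolyAt u ((arithFrobPolyOfSatake ι u.residueCard (2 * n) β).scaleRoots t))
    {u : HeightOneSpectrum (𝓞 K)} (hu : TwistCtrl π eψ ι cK τ' θ u) :
    PatchCtrl (CtrlOf F₀ π eψ ι) r u := by
  intro P hP he
  obtain ⟨hv, α, c, hg, rfl⟩ := hP
  obtain ⟨⟨β, hβ⟩, hcu, hctrl⟩ := hu α c hv hg he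
  obtain ⟨t, hθ, h1, h2⟩ := hctrl β hβ
  have hbc := hstrong u β he hβ hcu
  obtain ⟨hunr, hchar⟩ := hr u β t hv he hbc hθ
  refine ⟨hunr, fun hf ↦ ?_, fun hf ↦ ?_⟩
  · rw [← h1 hf]; exact hchar
  · rw [← h2 hf]; exact hchar

end Assembly

/-! ## The composition: the crux BY NAME from the five stubs -/

/-- **Skeleton theorem.**  `HostInducedRep` follows from the five stubs: S1 gives the induced
package `Π` and the riders; S2 gives the finite set `T` and, for every admissible `K` and auxiliary
place `v₀`, the signed twist `(τ', θ)`; for such `K` S3 descends `τ'` to a cuspidal `σ` on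
`U_{K/F₀}(2n)` with strong unramified correspondence and the archimedean shape, S4 attaches the
twisted Galois representation `r_{K,v₀}`, and the K-level glue turns twist control into patch
control; S5 patches the `r_{K,v₀}` over the admissible family to `R` over `F₀` with the crux's
conclusion at every guarded place `v ∤ ℓ`.  The only `sorry`s are inside the five stubs. -/
theorem HostInducedRep_of : HostInducedRep := by
  intro F₀ F _ _ _ _ _ τ hTR hdeg hτ n hcpt π e k hreg hpol hpar hodd ℓ _ ι hℓ hunr eψ hψunr hψpar hψnti
  have hH : Hyps τ n π e k ℓ eψ :=
    ⟨hTR, hdeg, hτ, hreg, hpol, hpar, hodd, hℓ, hunr, hψunr, hψpar, hψnti⟩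
  have hn : 0 < n := pos_of_twistNontrivial π (fun w ↦ τ • w)
    (fun w c ↦ eψ.HasFrobCharpolyAt w (X - C c)) (fun w c' ↦ eψ.HasFrobCharpolyAt (τ • w) (X - C c'))
    hψnti
  -- S1: the induced package
  obtain ⟨PInd, hPI, hℓ₀, hcof⟩ := stub_inducedPackage F₀ F τ n hcpt π e k ℓ eψ hH
  -- S2: the signed twists over the admissible CM quadratic fields
  obtain ⟨T, hT⟩ := stub_signedTwist F₀ F τ n hcpt π e k ℓ ι eψ hH PInd hPI
  -- the controlled polynomials at a place of F₀ are cofinitely inhabited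
  have hcof' : ∀ᶠ v : HeightOneSpectrum (𝓞 F₀) in cofinite, ∃ P, CtrlOf F₀ π eψ ι v P := by
    filter_upwards [hcof] with v hv
    obtain ⟨hvℓ, α, c, hg⟩ := hv
    exact ⟨hostPoly ι n α c v, hvℓ, α, c, hg, rfl⟩
  -- S3 + S4 for every admissible K, glued
  have hK : ∀ (K : Type) [Field K] [NumberField K] [Algebra F₀ K] (cK : K ≃ₐ[F₀] K), Adm ℓ T K cK →
      ∀ v₀ : HeightOneSpectrum (𝓞 F₀), ∃ r : FramedGaloisRep K (PadicAlgCl ℓ) (2 * n),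
        r.toGaloisRep.IsSemisimple ∧
          (∀ᶠ u : HeightOneSpectrum (𝓞 K) in cofinite, PatchCtrl (CtrlOf F₀ π eψ ι) r u) ∧
          ∀ u : HeightOneSpectrum (𝓞 K), u.under (𝓞 F₀) = v₀ → PatchCtrl (CtrlOf F₀ π eψ ι) r u := by
    intro K _ _ _ cK hadm v₀
    obtain ⟨h2, hc, htc, hKℓ, hKT⟩ := hadm
    obtain ⟨τ', θ, hcsd, hsign, harch, hunrℓ, hcof_u, hv₀⟩ := hT K cK ⟨h2, hc, htc, hKℓ, hKT⟩ v₀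
    obtain ⟨σ, -, hstrong, harchσ⟩ :=
      stub_grsExplicitDescent F₀ K cK h2 hc (2 * n) _ τ' (Nat.mul_pos two_pos hn) hcsd hsign
    have harch4 : ∀ (w : {w : InfinitePlace K // w.IsComplex}) (hw : cK • w.1 = w.1), ∃ Λ : Multiset ℂ,
        UnitaryGroup.HasHCParameterAt F₀ K cK (2 * n) (StdForm.antidiagonal (2 * n)) _ σ.1 hw hc Λ ∧
          HalfIntShape n Λ := by
      intro w hw
      obtain ⟨χ, hχ, hshape⟩ := harch
      obtain ⟨σe, -, hHC⟩ := harchσ χ hχ w hw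
      exact ⟨χ σe, hHC, hshape σe⟩
    have hunrσ : ∀ u : HeightOneSpectrum (𝓞 K), ((ℓ : ℕ) : 𝓞 K) ∈ u.asIdeal →
        UnitaryGroup.IsUnramifiedAt F₀ K cK (2 * n) _ σ.1 u := by
      intro u hu
      obtain ⟨he, ⟨β, hβ⟩, hcu⟩ := hunrℓ u hu
      exact ⟨β, hstrong u β he hβ hcu⟩
    obtain ⟨r, hrss, hr⟩ :=
      stub_gkPlacewise F₀ K cK hTR h2 hc htc n ℓ ι hℓ₀ hKℓ _ σ harch4 hunrσ θ
    refine ⟨r, hrss, ?_, fun u hu ↦ ?_⟩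
    · filter_upwards [hcof_u] with u hu
      exact patchCtrl_of_twistCtrl π eψ ι cK τ' θ σ r hstrong hr hu
    · exact patchCtrl_of_twistCtrl π eψ ι cK τ' θ σ r hstrong hr (hv₀ u hu)
  -- S5: patch over the family and read off over F₀
  obtain ⟨R, hRss, hR⟩ := stub_patchDescend F₀ ℓ (2 * n) T (CtrlOf F₀ π eψ ι) hcof' hK
  refine ⟨R, hRss, fun v α c hv hg ↦ ?_⟩
  exact hR v (hostPoly ι n α c v) ⟨hv, α, c, hg, rfl⟩

end Summit.Langlands.Langlands.Cruxes.HostInducedRep.GrsExplicitDescent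

end
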